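import Summits.NavierStokesRegularity.NavierStokesRegularity.Theorems.EfficiencyFloorRigidExitSliceRate
import Summits.NavierStokesRegularity.NavierStokesRegularity.Theorems.EfficiencyFloorRigidExitTangentConeRate
import Summits.NavierStokesRegularity.NavierStokesRegularity.Theorems.EfficiencyFloorRigidExitOrbitSelection
import HarnessLib

/-!
# Route `EfficiencyFloor`, support `RigidExit` (stmt-25513) on the `ProductionEfficiencyDecay` ladder (stmt-22866):
# (RATE) FROM THE CLASSIFICATION — orbit closedness, rebasing over the limit profile, and the slice

Helper file (`--supports stmt-NavierStokesRegularity-22866`; line `efficiency_floor`), the glue («R-glue») between the landed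
compact-stabiliser slice `Slice.rate_of_orbit` (`…RigidExitSliceRate`, (RATE) for sequences in ONE symmetry orbit of the profile)
and the format of `TangentCone.earlyDeficit_everywhere_of_rate` (`…RigidExitTangentConeRate`, (RATE) for ARBITRARY
enstrophy-controlled pointwise tangent sequences of the normalised-maximiser set). Under the CLASSIFICATION half of clause (a) of
`MaximiserSetRigidity` (finitely many representatives `ms i`; every normalised maximiser is `l • R (ms i (l • R⁻¹(· − a)))`) the
two formats agree:

* `exists_ne_zero_of_enstrophy_pos`, `exists_strictMono_fiber` (§1): a profile with positive enstrophy is not identically zero;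
  a sequence with values in `Fin k` is constant along a subsequence (pigeonhole).
* `mem_orbit_of_tendsto_pointwise` (§2 — ORBIT CLOSEDNESS, abstract form of `OrbitClosed.mem_orbit_of_tendsto`): if orbit points
  `wₙ = lₙ • Rₙ (m₀ (lₙ • Rₙ⁻¹(· − bₙ)))` of a continuous profile `m₀` vanishing at infinity with `Z(m₀) > 0` converge POINTWISE to a
  profile `m ≢ 0` with `Z(wₙ) → Z(m) > 0`, then `m` lies in the orbit of `m₀` (scales are enstrophy ratios `…ScaleClock`;
  isometries subconverge; translations are bounded — else `wₙ(x₀) → 0 ≠ m(x₀)` — and subconverge; pointwise limits identify `m`).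
* `rebase` (§3): an orbit point of `m₀` is an orbit point of any other orbit point `m` of `m₀`, with explicit parameters in the
  operator format `(λ, C, C', a)` of `…RigidExitSliceGroup` (`C = R R₀⁻¹`, `C' = R₀ R⁻¹`, `λ = l/l₀`).
* `rate_of_classification` (§4): classification ⟹ (RATE) at constant `c`, viscosity `ν`, VERBATIM the hypothesis of
  `TangentCone.tangentCone_of_rate` — pigeonhole on the index, §2, §3, `λₙ → 1` from `Z(wₙ) → Z(m)`, then `Slice.rate_of_orbit`.
* (sequel `…RigidExitOrbitRateByName`): BY NAME corollaries — clause (a) ⟹ no maximiser interval and the early-deficit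
  inequality at EVERY slice time, for the sharp constant `c⋆`.

So item (i) ORBIT SELECTION / INSTANT EXIT of the READING of `RigidExit` is closed BY NAME given clause (a): what clause (a) must
still buy for `NearMaximiserBoundedAmplification` is only item (ii), the UNIFORM margin (continuous dependence in `Ḣ¹∩Ḣ²` over the
closed window). HONEST FRAMING: statements about a HYPOTHETICAL blow-up; clause (a), `RigidExit`, `NearMaximiserBoundedAmplification`,
`LerayFloorGap`, `ProductionEfficiencyDecay` (stmt-22866) and Navier–Stokes regularity stay OPEN; no summit statement is proved.
[folklore]
-/

-- the problem directory repeats the summit name (`NavierStokesRegularity/NavierStokesRegularity`)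
set_option linter.dupNamespace false

noncomputable section

open Set Filter MeasureTheory Topology Function Bornology
open scoped InnerProductSpace RealInnerProductSpace ENNReal NNReal
open Literature.Analysis.FluidPDE

namespace Summit.NavierStokesRegularity.NavierStokesRegularity.Theorems

namespace RigidExit

namespace OrbitRate

open NearMaximiserBoundedAmplification MaximiserSetRigidity.ProfileLiouville Resonance ScaleClock OrbitClosed ProfileDecay
  TangentCone Slice

/-! ## §1 Two small tools -/

/-- **A profile with positive enstrophy is not identically zero.** [folklore] -/
theorem exists_ne_zero_of_enstrophy_pos {m : EuclideanSpace ℝ (Fin 3) → EuclideanSpace ℝ (Fin 3)}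
    (hZm : 0 < ∫ x, ‖curl m x‖ ^ 2) : ∃ x, m x ≠ 0 := by
  by_contra h
  push Not at h
  have hu : m = fun _ => (0 : EuclideanSpace ℝ (Fin 3)) := funext h
  rw [hu] at hZm
  simp at hZm

/-- **Pigeonhole:** a sequence with values in `Fin k` is constant along a subsequence. [folklore] -/
theorem exists_strictMono_fiber {k : ℕ} (i : ℕ → Fin k) :
    ∃ (i₀ : Fin k) (φ : ℕ → ℕ), StrictMono φ ∧ ∀ n, i (φ n) = i₀ := by
  have hfreq : ∃ i₀ : Fin k, ∃ᶠ n in atTop, i n = i₀ := by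
    by_contra hcon
    push Not at hcon
    have hall : ∀ᶠ n in atTop, ∀ i₀ : Fin k, i n ≠ i₀ := by
      rw [eventually_all]
      exact fun i₀ => hcon i₀
    obtain ⟨n, hn⟩ := hall.exists
    exact hn (i n) rfl
  obtain ⟨i₀, hi₀⟩ := hfreq
  obtain ⟨φ, hφ, hφi⟩ := extraction_of_frequently_atTop hi₀
  exact ⟨i₀, φ, hφ, hφi⟩

/-! ## §2 Orbit closedness under enstrophy-controlled pointwise convergence -/

/-- **A symmetry orbit is closed under enstrophy-controlled pointwise convergence.** Let `m₀` be a continuous profile vanishing at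
infinity with `∫|curl m₀|² > 0`, and `wₙ = lₙ • Rₙ (m₀ (lₙ • Rₙ⁻¹(· − bₙ)))` orbit points (`lₙ > 0`, `Rₙ` linear isometries). If
`wₙ → m` pointwise, `∫|curl wₙ|² → ∫|curl m|² > 0` and `m x₀ ≠ 0` for some `x₀`, then `m` is an orbit point of `m₀`. [folklore] -/
theorem mem_orbit_of_tendsto_pointwise {m₀ m : EuclideanSpace ℝ (Fin 3) → EuclideanSpace ℝ (Fin 3)} (hm₀c : Continuous m₀)
    (hm₀0 : Tendsto m₀ (cocompact (EuclideanSpace ℝ (Fin 3))) (𝓝 0)) (hZm₀ : 0 < ∫ x, ‖curl m₀ x‖ ^ 2)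
    (hZm : 0 < ∫ x, ‖curl m x‖ ^ 2) {x₀ : EuclideanSpace ℝ (Fin 3)} (hx₀ : m x₀ ≠ 0)
    {w : ℕ → EuclideanSpace ℝ (Fin 3) → EuclideanSpace ℝ (Fin 3)}
    (hZ : Tendsto (fun n => ∫ x, ‖curl (w n) x‖ ^ 2) atTop (𝓝 (∫ x, ‖curl m x‖ ^ 2)))
    (hptw : ∀ x, Tendsto (fun n => w n x) atTop (𝓝 (m x)))
    (hmem : ∀ n, ∃ (a : EuclideanSpace ℝ (Fin 3)) (R : EuclideanSpace ℝ (Fin 3) ≃ₗᵢ[ℝ] EuclideanSpace ℝ (Fin 3)) (l : ℝ),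
      0 < l ∧ w n = fun x => l • R (m₀ (l • R.symm (x - a)))) :
    ∃ (a : EuclideanSpace ℝ (Fin 3)) (R : EuclideanSpace ℝ (Fin 3) ≃ₗᵢ[ℝ] EuclideanSpace ℝ (Fin 3)) (l : ℝ),
      0 < l ∧ m = fun x => l • R (m₀ (l • R.symm (x - a))) := by
  choose a R l hl hw using hmem
  -- scales are enstrophy ratios, hence converge to `Z(m)/Z(m₀) > 0`
  have hln : ∀ n, l n = (∫ x, ‖curl (w n) x‖ ^ 2) / ∫ x, ‖curl m₀ x‖ ^ 2 :=
    fun n => scale_eq_enstrophy_ratio' (hl n) hZm₀ (hw n)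
  set l₀ : ℝ := (∫ x, ‖curl m x‖ ^ 2) / ∫ x, ‖curl m₀ x‖ ^ 2 with hl₀
  have hl₀pos : 0 < l₀ := div_pos hZm hZm₀
  have hlconv : Tendsto l atTop (𝓝 l₀) := by
    have h1 : Tendsto (fun n => (∫ x, ‖curl (w n) x‖ ^ 2) / ∫ x, ‖curl m₀ x‖ ^ 2) atTop (𝓝 l₀) := hZ.div_const _
    exact h1.congr fun n => (hln n).symm
  -- isometries subconverge
  obtain ⟨L, φ, hφ, hR1, hR2⟩ := exists_subseq_isometry R
  by_cases hb : ∃ r : ℝ, ∀ n, ‖a (φ n)‖ ≤ r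
  · -- bounded translations: subconverge, and pass to the limit pointwise
    obtain ⟨r, hr⟩ := hb
    obtain ⟨a₀, -, ψ, hψ, haconv⟩ := tendsto_subseq_of_bounded (Metric.isBounded_closedBall (x := (0 : EuclideanSpace ℝ (Fin 3)))
      (r := r)) (fun n => by rw [Metric.mem_closedBall, dist_zero_right]; exact hr n)
    refine ⟨a₀, L, l₀, hl₀pos, funext fun x => ?_⟩
    have hχ : StrictMono (φ ∘ ψ) := hφ.comp hψ
    have hlχ : Tendsto (fun k => l (φ (ψ k))) atTop (𝓝 l₀) := hlconv.comp hχ.tendsto_atTop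
    have haχ : Tendsto (fun k => a (φ (ψ k))) atTop (𝓝 a₀) := haconv
    have hR1χ := hR1.comp hψ.tendsto_atTop
    have hR2χ := hR2.comp hψ.tendsto_atTop
    have hinner : Tendsto (fun k => l (φ (ψ k)) • (R (φ (ψ k))).symm (x - a (φ (ψ k)))) atTop (𝓝 (l₀ • L.symm (x - a₀))) := by
      have h1 : Tendsto (fun k => ((R (φ (ψ k))).symm.toContinuousLinearEquiv : EuclideanSpace ℝ (Fin 3) →L[ℝ] EuclideanSpace ℝ (Fin 3))
          (x - a (φ (ψ k)))) atTop (𝓝 ((L.symm.toContinuousLinearEquiv : EuclideanSpace ℝ (Fin 3) →L[ℝ] EuclideanSpace ℝ (Fin 3))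
          (x - a₀))) := tendsto_clm_apply hR2χ (tendsto_const_nhds.sub haχ)
      have h2 := hlχ.smul h1
      simpa using h2
    have hm : Tendsto (fun k => m₀ (l (φ (ψ k)) • (R (φ (ψ k))).symm (x - a (φ (ψ k))))) atTop
        (𝓝 (m₀ (l₀ • L.symm (x - a₀)))) := (hm₀c.tendsto _).comp hinner
    have houter : Tendsto (fun k => l (φ (ψ k)) • R (φ (ψ k)) (m₀ (l (φ (ψ k)) • (R (φ (ψ k))).symm (x - a (φ (ψ k))))))
        atTop (𝓝 (l₀ • L (m₀ (l₀ • L.symm (x - a₀))))) := by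
      have h1 : Tendsto (fun k => ((R (φ (ψ k))).toContinuousLinearEquiv : EuclideanSpace ℝ (Fin 3) →L[ℝ] EuclideanSpace ℝ (Fin 3))
          (m₀ (l (φ (ψ k)) • (R (φ (ψ k))).symm (x - a (φ (ψ k)))))) atTop
          (𝓝 ((L.toContinuousLinearEquiv : EuclideanSpace ℝ (Fin 3) →L[ℝ] EuclideanSpace ℝ (Fin 3)) (m₀ (l₀ • L.symm (x - a₀))))) :=
        tendsto_clm_apply hR1χ hm
      have h2 := hlχ.smul h1
      simpa using h2
    have hux : Tendsto (fun k => w (φ (ψ k)) x) atTop (𝓝 (l₀ • L (m₀ (l₀ • L.symm (x - a₀))))) := by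
      refine houter.congr fun k => ?_
      rw [hw (φ (ψ k))]
    exact tendsto_nhds_unique ((hptw x).comp hχ.tendsto_atTop) hux
  · -- unbounded translations: the orbit points would tend to `0` at `x₀`, where `m x₀ ≠ 0`
    exfalso
    obtain ⟨ψ, hψ, hnorm⟩ := exists_subseq_norm_tendsto_atTop hb
    have hχ : StrictMono (φ ∘ ψ) := hφ.comp hψ
    have hlχ : Tendsto (fun k => l (φ (ψ k))) atTop (𝓝 l₀) := hlconv.comp hχ.tendsto_atTop
    -- the arguments `yₖ = lₖ • Rₖ⁻¹ (x₀ − aₖ)` escape to infinity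
    set y : ℕ → EuclideanSpace ℝ (Fin 3) := fun k => l (φ (ψ k)) • (R (φ (ψ k))).symm (x₀ - a (φ (ψ k))) with hy
    have hny : ∀ k, ‖y k‖ = l (φ (ψ k)) * ‖x₀ - a (φ (ψ k))‖ := fun k => by
      simp only [hy, norm_smul, LinearIsometryEquiv.norm_map, Real.norm_eq_abs, abs_of_pos (hl _)]
    have hdiff : Tendsto (fun k => ‖x₀ - a (φ (ψ k))‖) atTop atTop := by
      have h1 : ∀ k, ‖a (φ (ψ k))‖ - ‖x₀‖ ≤ ‖x₀ - a (φ (ψ k))‖ := fun k => by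
        have := norm_sub_norm_le (a (φ (ψ k))) x₀
        rw [norm_sub_rev] at this
        linarith
      refine tendsto_atTop_mono h1 ?_
      exact (tendsto_atTop_add_const_right _ (-‖x₀‖) hnorm).congr fun k => by ring
    have hyn : Tendsto (fun k => ‖y k‖) atTop atTop := by
      have := hlχ.pos_mul_atTop hl₀pos hdiff
      exact this.congr fun k => (hny k).symm
    have hyco : Tendsto y atTop (cocompact (EuclideanSpace ℝ (Fin 3))) := by
      rw [← Metric.cobounded_eq_cocompact]
      exact tendsto_norm_atTop_iff_cobounded.1 hyn
    have hmy : Tendsto (fun k => m₀ (y k)) atTop (𝓝 0) := hm₀0.comp hyco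
    -- hence `wₙ x₀ → 0` along the subsequence
    have hux : Tendsto (fun k => w (φ (ψ k)) x₀) atTop (𝓝 0) := by
      have h1 : Tendsto (fun k => ‖w (φ (ψ k)) x₀‖) atTop (𝓝 0) := by
        have h2 : ∀ k, ‖w (φ (ψ k)) x₀‖ = l (φ (ψ k)) * ‖m₀ (y k)‖ := fun k => by
          rw [hw (φ (ψ k))]
          simp only [hy, norm_smul, LinearIsometryEquiv.norm_map, Real.norm_eq_abs, abs_of_pos (hl _)]
        have h3 : Tendsto (fun k => l (φ (ψ k)) * ‖m₀ (y k)‖) atTop (𝓝 (l₀ * 0)) :=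
          hlχ.mul (tendsto_zero_iff_norm_tendsto_zero.1 hmy)
        rw [mul_zero] at h3
        exact h3.congr fun k => (h2 k).symm
      exact tendsto_zero_iff_norm_tendsto_zero.2 h1
    have := tendsto_nhds_unique ((hptw x₀).comp hχ.tendsto_atTop) hux
    exact hx₀ this

/-! ## §3 Rebasing an orbit point over another orbit point -/

/-- **Rebasing.** If `w = l • R (m₀ (l • R⁻¹(· − b)))` and `m = l₀ • R₀ (m₀ (l₀ • R₀⁻¹(· − a)))` (`l, l₀ > 0`), then `w` is the orbit
point of `m` ITSELF with parameters `λ = l/l₀`, `C = R R₀⁻¹`, `C' = R₀ R⁻¹`, translation `b − λ⁻¹ • C a` (operator format of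
`…RigidExitSliceGroup`). [folklore] -/
theorem rebase {m₀ m w : EuclideanSpace ℝ (Fin 3) → EuclideanSpace ℝ (Fin 3)} {a b : EuclideanSpace ℝ (Fin 3)}
    {R R₀ : EuclideanSpace ℝ (Fin 3) ≃ₗᵢ[ℝ] EuclideanSpace ℝ (Fin 3)} {l l₀ : ℝ} (hl : 0 < l) (hl₀ : 0 < l₀)
    (hm : m = fun x => l₀ • R₀ (m₀ (l₀ • R₀.symm (x - a))))
    (hw : w = fun x => l • R (m₀ (l • R.symm (x - b)))) :
    w = fun x => (l / l₀) • (((R.toContinuousLinearEquiv : EuclideanSpace ℝ (Fin 3) →L[ℝ] EuclideanSpace ℝ (Fin 3)) *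
        (R₀.symm.toContinuousLinearEquiv : EuclideanSpace ℝ (Fin 3) →L[ℝ] EuclideanSpace ℝ (Fin 3)))
      (m ((l / l₀) • ((R₀.toContinuousLinearEquiv : EuclideanSpace ℝ (Fin 3) →L[ℝ] EuclideanSpace ℝ (Fin 3)) *
        ((R.symm.toContinuousLinearEquiv : EuclideanSpace ℝ (Fin 3) →L[ℝ] EuclideanSpace ℝ (Fin 3)))) (x - (b - (l / l₀)⁻¹ •
        ((R.toContinuousLinearEquiv : EuclideanSpace ℝ (Fin 3) →L[ℝ] EuclideanSpace ℝ (Fin 3)) *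
        (R₀.symm.toContinuousLinearEquiv : EuclideanSpace ℝ (Fin 3) →L[ℝ] EuclideanSpace ℝ (Fin 3))) a))))) := by
  rw [hw, hm]
  funext x
  have hl0 : l₀ ≠ 0 := hl₀.ne'
  have hq : l / l₀ ≠ 0 := div_ne_zero hl.ne' hl0
  have e1 : l₀ * (l / l₀) = l := by field_simp
  -- the inner arguments agree
  have hin : l₀ • R₀.symm ((l / l₀) • ((R₀.toContinuousLinearEquiv : EuclideanSpace ℝ (Fin 3) →L[ℝ] EuclideanSpace ℝ (Fin 3)) *
        ((R.symm.toContinuousLinearEquiv : EuclideanSpace ℝ (Fin 3) →L[ℝ] EuclideanSpace ℝ (Fin 3)))) (x - (b - (l / l₀)⁻¹ •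
        ((R.toContinuousLinearEquiv : EuclideanSpace ℝ (Fin 3) →L[ℝ] EuclideanSpace ℝ (Fin 3)) *
        (R₀.symm.toContinuousLinearEquiv : EuclideanSpace ℝ (Fin 3) →L[ℝ] EuclideanSpace ℝ (Fin 3))) a)) - a) =
      l • R.symm (x - b) := by
    simp only [mul_apply_eq_comp, ContinuousLinearEquiv.coe_coe, LinearIsometryEquiv.coe_toContinuousLinearEquiv,
      map_sub, map_smul, LinearIsometryEquiv.apply_symm_apply, LinearIsometryEquiv.symm_apply_apply, smul_sub, smul_smul]
    rw [mul_inv_cancel₀ hq, mul_one, e1]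
    abel
  dsimp only
  rw [hin]
  simp only [mul_apply_eq_comp, ContinuousLinearEquiv.coe_coe, LinearIsometryEquiv.coe_toContinuousLinearEquiv,
    map_smul, LinearIsometryEquiv.symm_apply_apply, smul_smul]
  rw [div_mul_cancel₀ l hl0]

/-! ## §4 (RATE) from the classification -/

/-- **Classification ⟹ (RATE).** For `c, ν` and finitely many normalised-maximiser representatives `ms i` (admissible, positive
enstrophy) classifying the normalised maximisers at constant `c`, viscosity `ν` modulo the symmetry group (clause (a) of
`MaximiserSetRigidity`, classification half, VERBATIM), the set of normalised maximisers has the property (RATE) — VERBATIM the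
hypothesis of `TangentCone.tangentCone_of_rate`: every enstrophy-controlled pointwise tangent sequence `wₙ → m` admits, along a
subsequence, orbit representatives over `m` with CONVERGENT parameter difference quotients. Mechanism: one index `i₀` infinitely
often (§1); `m` lies in the orbit of `ms i₀` (§2); rebase over `m` (§3); `λₙ = lₙ/l₀ → 1` by `Z(wₙ) → Z(m)`; `Slice.rate_of_orbit`.
[folklore] -/
theorem rate_of_classification {c ν : ℝ}
    {k : ℕ} (ms : Fin k → EuclideanSpace ℝ (Fin 3) → EuclideanSpace ℝ (Fin 3))
    (hms : ∀ i, (ContDiff ℝ (⊤ : ℕ∞) (ms i) ∧ VectorCalculus.IsDivFree (ms i) ∧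
        (∫⁻ x, ‖iteratedFDeriv ℝ 0 (ms i) x‖ₑ ^ 2 < ⊤) ∧ (∫⁻ x, ‖iteratedFDeriv ℝ 1 (ms i) x‖ₑ ^ 2 < ⊤) ∧
        (∫⁻ x, ‖iteratedFDeriv ℝ 2 (ms i) x‖ₑ ^ 2 < ⊤)) ∧ 0 < (∫ x, ‖curl (ms i) x‖ ^ 2))
    (hclass : ∀ m : EuclideanSpace ℝ (Fin 3) → EuclideanSpace ℝ (Fin 3), ((ContDiff ℝ (⊤ : ℕ∞) m ∧ VectorCalculus.IsDivFree m ∧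
        (∫⁻ x, ‖iteratedFDeriv ℝ 0 m x‖ₑ ^ 2 < ⊤) ∧ (∫⁻ x, ‖iteratedFDeriv ℝ 1 m x‖ₑ ^ 2 < ⊤) ∧
        (∫⁻ x, ‖iteratedFDeriv ℝ 2 m x‖ₑ ^ 2 < ⊤)) ∧ 0 < (∫ x, ‖curl m x‖ ^ 2) ∧
        (∫ x, ⟪curl m x, fderiv ℝ m x (curl m x)⟫_ℝ) = c * (∫ x, ‖curl m x‖ ^ 2) ^ (3 / 4 : ℝ) *
          (∫ x, frobeniusNormSq (fderiv ℝ (curl m) x)) ^ (3 / 4 : ℝ) ∧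
        (∫ x, frobeniusNormSq (fderiv ℝ (curl m) x)) = 81 * c ^ 4 / (256 * ν ^ 4) * (∫ x, ‖curl m x‖ ^ 2) ^ 3) →
      ∃ (i : Fin k) (a : EuclideanSpace ℝ (Fin 3)) (R : EuclideanSpace ℝ (Fin 3) ≃ₗᵢ[ℝ] EuclideanSpace ℝ (Fin 3)) (l : ℝ),
        0 < l ∧ m = fun x => l • R (ms i (l • R.symm (x - a)))) :
    (∀ m : EuclideanSpace ℝ (Fin 3) → EuclideanSpace ℝ (Fin 3), (((ContDiff ℝ (⊤ : ℕ∞) m ∧ VectorCalculus.IsDivFree m ∧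
        (∫⁻ x, ‖iteratedFDeriv ℝ 0 m x‖ₑ ^ 2 < ⊤) ∧ (∫⁻ x, ‖iteratedFDeriv ℝ 1 m x‖ₑ ^ 2 < ⊤) ∧
        (∫⁻ x, ‖iteratedFDeriv ℝ 2 m x‖ₑ ^ 2 < ⊤)) ∧ 0 < (∫ x, ‖curl m x‖ ^ 2) ∧
        (∫ x, ⟪curl m x, fderiv ℝ m x (curl m x)⟫_ℝ) = c * (∫ x, ‖curl m x‖ ^ 2) ^ (3 / 4 : ℝ) *
          (∫ x, frobeniusNormSq (fderiv ℝ (curl m) x)) ^ (3 / 4 : ℝ) ∧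
        (∫ x, frobeniusNormSq (fderiv ℝ (curl m) x)) = 81 * c ^ 4 / (256 * ν ^ 4) * (∫ x, ‖curl m x‖ ^ 2) ^ 3)) →
        ∀ (w : ℕ → EuclideanSpace ℝ (Fin 3) → EuclideanSpace ℝ (Fin 3)) (τ : ℕ → ℝ) (h : EuclideanSpace ℝ (Fin 3) → EuclideanSpace ℝ (Fin 3)),
          (∀ n, (((ContDiff ℝ (⊤ : ℕ∞) (w n) ∧ VectorCalculus.IsDivFree (w n) ∧
        (∫⁻ x, ‖iteratedFDeriv ℝ 0 (w n) x‖ₑ ^ 2 < ⊤) ∧ (∫⁻ x, ‖iteratedFDeriv ℝ 1 (w n) x‖ₑ ^ 2 < ⊤) ∧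
        (∫⁻ x, ‖iteratedFDeriv ℝ 2 (w n) x‖ₑ ^ 2 < ⊤)) ∧ 0 < (∫ x, ‖curl (w n) x‖ ^ 2) ∧
        (∫ x, ⟪curl (w n) x, fderiv ℝ (w n) x (curl (w n) x)⟫_ℝ) = c * (∫ x, ‖curl (w n) x‖ ^ 2) ^ (3 / 4 : ℝ) *
          (∫ x, frobeniusNormSq (fderiv ℝ (curl (w n)) x)) ^ (3 / 4 : ℝ) ∧
        (∫ x, frobeniusNormSq (fderiv ℝ (curl (w n)) x)) = 81 * c ^ 4 / (256 * ν ^ 4) * (∫ x, ‖curl (w n) x‖ ^ 2) ^ 3))) → (∀ n, 0 < τ n) → Tendsto τ atTop (𝓝 0) →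
          Tendsto (fun n => ∫ x, ‖curl (w n) x‖ ^ 2) atTop (𝓝 (∫ x, ‖curl m x‖ ^ 2)) →
          (∀ x, Tendsto (fun n => (τ n)⁻¹ • (w n x - m x)) atTop (𝓝 (h x))) →
          ∃ (φ : ℕ → ℕ) (lam : ℕ → ℝ) (C C' : ℕ → (EuclideanSpace ℝ (Fin 3) →L[ℝ] EuclideanSpace ℝ (Fin 3))) (a : ℕ → EuclideanSpace ℝ (Fin 3)) (l' : ℝ)
            (Rd Rd' : EuclideanSpace ℝ (Fin 3) →L[ℝ] EuclideanSpace ℝ (Fin 3)) (ad : EuclideanSpace ℝ (Fin 3)),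
            StrictMono φ ∧ (∀ n v, C' n (C n v) = v) ∧ (∀ n (v v' : EuclideanSpace ℝ (Fin 3)), ⟪C n v, C n v'⟫_ℝ = ⟪v, v'⟫_ℝ) ∧
            (∀ n, w (φ n) = fun x => lam n • C n (m (lam n • C' n (x - a n)))) ∧
            Tendsto (fun n => (τ (φ n))⁻¹ * (lam n - 1)) atTop (𝓝 l') ∧
            Tendsto (fun n => (τ (φ n))⁻¹ • (C n - ContinuousLinearMap.id ℝ (EuclideanSpace ℝ (Fin 3)))) atTop (𝓝 Rd) ∧
            Tendsto (fun n => (τ (φ n))⁻¹ • (C' n - ContinuousLinearMap.id ℝ (EuclideanSpace ℝ (Fin 3)))) atTop (𝓝 Rd') ∧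
            Tendsto (fun n => (τ (φ n))⁻¹ • a n) atTop (𝓝 ad)) := by
  intro m hm w τ h hw hτpos hτ0 hZ hptwq
  -- pointwise convergence of the orbit points
  have hptw : ∀ x, Tendsto (fun n => w n x) atTop (𝓝 (m x)) := by
    intro x
    have h1 := tendsto_zero_of_rate (x := fun n => w n x - m x) (L := h x) hτ0 (hptwq x) (fun n => (hτpos n).ne')
    have h2 := h1.add_const (m x)
    rw [zero_add] at h2
    exact h2.congr fun n => by simp only [sub_add_cancel]
  -- classify every `w n`; one index occurs along a subsequence
  choose i b R l hl hwrep using fun n => hclass (w n) (hw n)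
  obtain ⟨i₀, φ₁, hφ₁, hi₀⟩ := exists_strictMono_fiber i
  -- the representative and the profile
  have hm₀c : Continuous (ms i₀) := (hms i₀).1.1.continuous
  have hm₀0 : Tendsto (ms i₀) (cocompact (EuclideanSpace ℝ (Fin 3))) (𝓝 0) := tendsto_cocompact_of_admissible (hms i₀).1
  have hZm₀ : 0 < ∫ x, ‖curl (ms i₀) x‖ ^ 2 := (hms i₀).2
  have hmc : Continuous m := hm.1.1.continuous
  have hmd : Differentiable ℝ m := hm.1.1.differentiable (by simp)
  have hm0 : Tendsto m (cocompact (EuclideanSpace ℝ (Fin 3))) (𝓝 0) := tendsto_cocompact_of_admissible hm.1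
  have hZm : 0 < ∫ x, ‖curl m x‖ ^ 2 := hm.2.1
  obtain ⟨x₀, hx₀⟩ := exists_ne_zero_of_enstrophy_pos hZm
  -- `m` lies in the orbit of `ms i₀`
  have hwrep' : ∀ n, w (φ₁ n) = fun x => l (φ₁ n) • R (φ₁ n) (ms i₀ (l (φ₁ n) • (R (φ₁ n)).symm (x - b (φ₁ n)))) := by
    intro n
    rw [← hi₀ n]
    exact hwrep (φ₁ n)
  have hmem : ∀ n, ∃ (a : EuclideanSpace ℝ (Fin 3)) (R : EuclideanSpace ℝ (Fin 3) ≃ₗᵢ[ℝ] EuclideanSpace ℝ (Fin 3)) (l : ℝ),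
      0 < l ∧ w (φ₁ n) = fun x => l • R (ms i₀ (l • R.symm (x - a))) :=
    fun n => ⟨b (φ₁ n), R (φ₁ n), l (φ₁ n), hl _, hwrep' n⟩
  have hZ₁ : Tendsto (fun n => ∫ x, ‖curl (w (φ₁ n)) x‖ ^ 2) atTop (𝓝 (∫ x, ‖curl m x‖ ^ 2)) := hZ.comp hφ₁.tendsto_atTop
  obtain ⟨a₀, R₀, l₀, hl₀, hmrep⟩ := mem_orbit_of_tendsto_pointwise hm₀c hm₀0 hZm₀ hZm hx₀ hZ₁
    (fun x => (hptw x).comp hφ₁.tendsto_atTop) hmem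
  -- rebase over `m`
  set lam : ℕ → ℝ := fun n => l (φ₁ n) / l₀ with hlam
  set C : ℕ → (EuclideanSpace ℝ (Fin 3) →L[ℝ] EuclideanSpace ℝ (Fin 3)) := fun n =>
    ((R (φ₁ n)).toContinuousLinearEquiv : EuclideanSpace ℝ (Fin 3) →L[ℝ] EuclideanSpace ℝ (Fin 3)) *
      (R₀.symm.toContinuousLinearEquiv : EuclideanSpace ℝ (Fin 3) →L[ℝ] EuclideanSpace ℝ (Fin 3)) with hC
  set C' : ℕ → (EuclideanSpace ℝ (Fin 3) →L[ℝ] EuclideanSpace ℝ (Fin 3)) := fun n =>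
    (R₀.toContinuousLinearEquiv : EuclideanSpace ℝ (Fin 3) →L[ℝ] EuclideanSpace ℝ (Fin 3)) *
      ((R (φ₁ n)).symm.toContinuousLinearEquiv : EuclideanSpace ℝ (Fin 3) →L[ℝ] EuclideanSpace ℝ (Fin 3)) with hC'
  set a : ℕ → EuclideanSpace ℝ (Fin 3) := fun n => b (φ₁ n) - (lam n)⁻¹ • C n a₀ with ha
  have hlampos : ∀ n, 0 < lam n := fun n => div_pos (hl _) hl₀
  have hinv : ∀ n v, C' n (C n v) = v := fun n v => by simp [hC, hC']
  have hinv' : ∀ n v, C n (C' n v) = v := fun n v => by simp [hC, hC']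
  have hiso : ∀ n (v v' : EuclideanSpace ℝ (Fin 3)), ⟪C n v, C n v'⟫_ℝ = ⟪v, v'⟫_ℝ := fun n v v' => by
    simp [hC, LinearIsometryEquiv.inner_map_map]
  have hrep : ∀ n, w (φ₁ n) = fun x => lam n • C n (m (lam n • C' n (x - a n))) :=
    fun n => rebase (hl (φ₁ n)) hl₀ hmrep (hwrep' n)
  -- `λₙ → 1`
  have hlam1 : Tendsto lam atTop (𝓝 1) := by
    have hln : ∀ n, l (φ₁ n) = (∫ x, ‖curl (w (φ₁ n)) x‖ ^ 2) / ∫ x, ‖curl (ms i₀) x‖ ^ 2 :=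
      fun n => scale_eq_enstrophy_ratio' (hl (φ₁ n)) hZm₀ (hwrep' n)
    have hl₀eq : l₀ = (∫ x, ‖curl m x‖ ^ 2) / ∫ x, ‖curl (ms i₀) x‖ ^ 2 := scale_eq_enstrophy_ratio' hl₀ hZm₀ hmrep
    have h1 : Tendsto (fun n => l (φ₁ n)) atTop (𝓝 l₀) := by
      rw [hl₀eq]
      exact (hZ₁.div_const _).congr fun n => (hln n).symm
    have h2 := h1.div_const l₀
    rwa [div_self hl₀.ne'] at h2
  -- the difference quotients in rebased form
  have hh : ∀ x, Tendsto (fun n => (τ (φ₁ n))⁻¹ • (lam n • C n (m (lam n • C' n (x - a n))) - m x)) atTop (𝓝 (h x)) := by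
    intro x
    refine ((hptwq x).comp hφ₁.tendsto_atTop).congr fun n => ?_
    rw [Function.comp_apply, hrep n]
  obtain ⟨φ, lam₂, D, D', a₂, l', Rd, Rd', ad, hφ, hDinv, hDiso, hrep₂, hl', hRd, hRd', had⟩ :=
    rate_of_orbit hmc hmd hm0 hx₀ hlampos hinv hinv' hiso hlam1 (τ := fun n => τ (φ₁ n)) (fun n => hτpos _)
      (hτ0.comp hφ₁.tendsto_atTop) hh
  refine ⟨φ₁ ∘ φ, lam₂, D, D', a₂, l', Rd, Rd', ad, hφ₁.comp hφ, hDinv, hDiso, fun n => ?_, hl', hRd, hRd', had⟩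
  rw [Function.comp_apply, hrep (φ n)]
  exact hrep₂ n

end OrbitRate

end RigidExit

end Summit.NavierStokesRegularity.NavierStokesRegularity.Theorems

end
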